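import Mathlib
import Literature.Dynamics.FixedPoints.DominatedUnstableSetNull
import HarnessLib.Audit

/-!
# Crux E `PowerGaugeEulerLiouville` (stmt-NavierStokesRegularity-19832): THE DOMINATED PAST-HISTORY LEMMA FOR AN ITERATE —
# the backward basin of a fixed point is null as soon as SOME POWER of the linearisation has a dominated contracting splitting
# (width seat ns-cas-k2 g3, lane «DSS thin vortical nodes», tool A)

Route `EulerZoomLiouville` (NavierStokesRegularity), crux E.  Generic dynamics (any finite-dimensional real normed space), feeding the
DSS node theorem of this lane: the rescaled period map `F` of a discretely self-similar member at a permanent node `p` has a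
linearisation `DF(p)` whose contracting direction is dominated only up to constants (non-normal `3 × 3` operator), so the one-step
rates `‖DF(p)|Es‖ ≤ a < 1`, `‖DF(p)x‖ ≥ b‖x‖` (`a < b`) of the Literature cone lemma
`Literature.Dynamics.FixedPoints.addHaar_pastHistorySet_eq_zero_of_dominated` are available only for a POWER `DF(p)^k`.  This file
supplies the bookkeeping:
* `iterate_apply_pastHistory` — an `F`-past history `F(q_{j+1}) = q_j` has `F^[i] q_{j+i} = q_j`;
* `fderiv_iterate_of_fixedPoint` — at a fixed point, `D(F^[k])(p) = DF(p)^k`;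
* `pow_mapsTo_of_mapsTo` — a subspace invariant under `L` is invariant under `L^k`;
* **`addHaar_pastHistorySet_eq_zero_of_dominated_pow`** — `F ∈ C¹`, `F p = p`, `DF(p)` preserves complementary `Es`, `Ec` (`Ec ≠ ⊤`) and for
  some `k ≥ 1`: `‖DF(p)^k x‖ ≤ a‖x‖` on `Es`, `b‖x‖ ≤ ‖DF(p)^k x‖` on `Ec`, `a < 1`, `a < b` ⇒ the set of points admitting an `F`-past history
  converging to `p` is null for every additive Haar measure (sub-sample the history along multiples of `k`).

WHAT THIS IS NOT: not NS regularity, not the crux E — a measure-zero tool for hypothetical DSS blow-up members; 19832 is OPEN.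
[folklore; Robinson1999 Ch. V §5.10.1 (cone estimate, dominated form — proved in the tree); KatokHasselblatt §6.2]
-/

noncomputable section

set_option linter.dupNamespace false

open MeasureTheory Set Filter Topology Metric Function

namespace Summit.NavierStokesRegularity.NavierStokesRegularity.Theorems.PowerGaugeEulerLiouville.DSSNodes

open Literature.Dynamics.FixedPoints

universe u

section Histories

variable {X : Type u}

/-- A past history of `F` recovers its initial points under iterates: `F^[i] (q_{j+i}) = q_j`. [folklore] -/
theorem iterate_apply_pastHistory {F : X → X} {qs : ℕ → X} (hqs : ∀ j, F (qs (j + 1)) = qs j) (i j : ℕ) :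
    F^[i] (qs (j + i)) = qs j := by
  induction i generalizing j with
  | zero => rfl
  | succ i ih =>
      rw [Function.iterate_succ_apply, show j + (i + 1) = (j + i) + 1 by ring, hqs (j + i)]
      exact ih j

/-- Sub-sampling a past history along multiples of `k`: `F^[k] (q_{k(j+1)}) = q_{kj}`. [folklore] -/
theorem iterate_apply_pastHistory_mul {F : X → X} {qs : ℕ → X} (hqs : ∀ j, F (qs (j + 1)) = qs j) (k j : ℕ) :
    F^[k] (qs (k * (j + 1))) = qs (k * j) := by
  rw [show k * (j + 1) = k * j + k by ring]
  exact iterate_apply_pastHistory hqs k (k * j)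

/-- A fixed point is fixed by every iterate. [folklore] -/
theorem iterate_apply_of_fixedPoint {F : X → X} {p : X} (hp : F p = p) (k : ℕ) : F^[k] p = p :=
  Function.iterate_fixed hp k

end Histories

variable {E : Type u} [NormedAddCommGroup E] [NormedSpace ℝ E]

/-- Iterates of a differentiable map are differentiable. [folklore] -/
theorem differentiable_iterate {F : E → E} (hF : Differentiable ℝ F) (k : ℕ) : Differentiable ℝ (F^[k]) := by
  induction k with
  | zero => exact differentiable_id
  | succ k ih => rw [Function.iterate_succ]; exact ih.comp hF

/-- Iterates of a `C¹` map are `C¹`. [folklore] -/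
theorem contDiff_iterate {F : E → E} {n : WithTop ℕ∞} (hF : ContDiff ℝ n F) (k : ℕ) : ContDiff ℝ n (F^[k]) := by
  induction k with
  | zero => exact contDiff_id
  | succ k ih => rw [Function.iterate_succ]; exact ih.comp hF

/-- **At a fixed point, `D(F^[k])(p) = DF(p)^k`** (chain rule). [folklore] -/
theorem fderiv_iterate_of_fixedPoint {F : E → E} {p : E} (hF : Differentiable ℝ F) (hp : F p = p) (k : ℕ) :
    fderiv ℝ (F^[k]) p = (fderiv ℝ F p) ^ k := by
  induction k with
  | zero =>
      rw [Function.iterate_zero, pow_zero, fderiv_id]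
      rfl
  | succ k ih =>
      rw [Function.iterate_succ, fderiv_comp p (differentiable_iterate hF k (F p)) (hF p), hp, ih, pow_succ]
      rfl

/-- A subspace invariant under `L` is invariant under every power `L^k`. [folklore] -/
theorem pow_mapsTo_of_mapsTo {L : E →L[ℝ] E} {V : Submodule ℝ E} (hV : ∀ x ∈ V, L x ∈ V) (k : ℕ) :
    ∀ x ∈ V, (L ^ k) x ∈ V := by
  induction k with
  | zero => intro x hx; simpa using hx
  | succ k ih =>
      intro x hx
      rw [pow_succ, ContinuousLinearMap.mul_def, ContinuousLinearMap.comp_apply]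
      exact ih _ (hV x hx)

variable [FiniteDimensional ℝ E] [MeasurableSpace E] [BorelSpace E]

/-- **THE DOMINATED PAST-HISTORY LEMMA FOR AN ITERATE.**  Let `F : E → E` be `C¹` with `F p = p`, and let `DF(p)` preserve the
complementary subspaces `Es`, `Ec` with `Ec ≠ ⊤`.  Suppose that for some `k ≥ 1` the power `DF(p)^k` contracts `Es` at rate `a < 1` and is
bounded below on `Ec` at a rate `b > a`: `‖DF(p)^k x‖ ≤ a‖x‖` (`x ∈ Es`), `b‖x‖ ≤ ‖DF(p)^k x‖` (`x ∈ Ec`).  Then the set of points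
admitting an `F`-past history (`F(q_{j+1}) = q_j`, `q_0 = q`) converging to `p` is null for every additive Haar measure.  Proof:
`D(F^[k])(p) = DF(p)^k` and an `F`-history sub-sampled along multiples of `k` is an `F^[k]`-history, so the Literature lemma for
`F^[k]` applies. [cite: Robinson1999, Ch. V §5.10.1 (cone estimate, dominated form; proved in the tree)] -/
theorem addHaar_pastHistorySet_eq_zero_of_dominated_pow (μ : Measure E) [μ.IsAddHaarMeasure]
    {F : E → E} {p : E} (hF : ContDiff ℝ 1 F) (hp : F p = p) {Es Ec : Submodule ℝ E}
    (hcompl : IsCompl Es Ec) (hs : ∀ x ∈ Es, fderiv ℝ F p x ∈ Es) (hc : ∀ x ∈ Ec, fderiv ℝ F p x ∈ Ec)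
    {k : ℕ} (hk : 0 < k) {a b : ℝ} (ha1 : a < 1) (hab : a < b)
    (hcon : ∀ x ∈ Es, ‖((fderiv ℝ F p) ^ k) x‖ ≤ a * ‖x‖) (hdom : ∀ x ∈ Ec, b * ‖x‖ ≤ ‖((fderiv ℝ F p) ^ k) x‖)
    (hEc : Ec ≠ ⊤) :
    μ {q | ∃ qs : ℕ → E, qs 0 = q ∧ (∀ j, F (qs (j + 1)) = qs j) ∧ Tendsto qs atTop (𝓝 p)} = 0 := by
  have hFd : Differentiable ℝ F := hF.differentiable one_ne_zero
  have hG : ContDiff ℝ 1 (F^[k]) := contDiff_iterate hF k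
  have hDG : fderiv ℝ (F^[k]) p = (fderiv ℝ F p) ^ k := fderiv_iterate_of_fixedPoint hFd hp k
  have hsG : ∀ x ∈ Es, fderiv ℝ (F^[k]) p x ∈ Es := by
    rw [hDG]; exact pow_mapsTo_of_mapsTo hs k
  have hcG : ∀ x ∈ Ec, fderiv ℝ (F^[k]) p x ∈ Ec := by
    rw [hDG]; exact pow_mapsTo_of_mapsTo hc k
  have hconG : ∀ x ∈ Es, ‖fderiv ℝ (F^[k]) p x‖ ≤ a * ‖x‖ := by rw [hDG]; exact hcon
  have hdomG : ∀ x ∈ Ec, b * ‖x‖ ≤ ‖fderiv ℝ (F^[k]) p x‖ := by rw [hDG]; exact hdom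
  have hnull := addHaar_pastHistorySet_eq_zero_of_dominated μ hG hcompl hsG hcG ha1 hab hconG hdomG hEc
  refine measure_mono_null (fun q hq => ?_) hnull
  obtain ⟨qs, h0, hstep, hlim⟩ := hq
  refine ⟨fun j => qs (k * j), by simpa using h0, fun j => iterate_apply_pastHistory_mul hstep k j, ?_⟩
  have hmul : Tendsto (fun j : ℕ => k * j) atTop atTop :=
    Filter.tendsto_id.const_mul_atTop' hk
  exact hlim.comp hmul

end Summit.NavierStokesRegularity.NavierStokesRegularity.Theorems.PowerGaugeEulerLiouville.DSSNodes

end
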